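import Summits.AnomalousDissipation.AnomalousDissipation.Theses.KolmogorovLiouville
import Literature.Analysis.FluidPDE.SteadyNSLiouville
import Literature.Analysis.FluidPDE.ClassicalSuitable

/-!
# Crux `SubBallisticLiouville` (stmt-AnomalousDissipation-3018) — strength theorem (strategist r1)

The crux
`Summit.AnomalousDissipation.AnomalousDissipation.Theses.KolmogorovLiouville.SubBallisticLiouville`
(route `KolmogorovLiouville`, the deciding crux of `closes : … → ¬ AnomalousDissipation`) asserts:
every eternal pressure-free energy-class very-weak solution `v` of unit-viscosity Navier–Stokes on
`ℝ × ℝ³` whose `L²`-oscillation grows sub-ballistically,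
`∫_{B_R} |v(t) − ⨍_{B_R} v(t)|² ≤ M R^{3+2h}` (`|t| ≤ R²`, `R ≥ 1`) for SOME `h < 1`,
has a.e.-constant time slices.

This file kernel-checks the fact the strategist censuses (`STRATEGY-CENSUS.md`, seat s1;
`STRATEGY-CENSUS-r1.md`, seat r1) lean on when they report `no-strategy-short-of-summit`:
**the crux at `h = 0` contains two named open Liouville problems for STEADY Navier–Stokes on `ℝ³`.**

* `exists_const_of_isLerayProfile_of_bounded` — `SubBallisticLiouville` ⇒ every bounded `C²/C¹`
  solution `(U, P)` of `−ΔU + (U·∇)U + ∇P = 0`, `div U = 0` on `ℝ³` (`IsLerayProfile 1 0 U P`) is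
  constant. The bounded-steady Liouville problem is open (Koch–Nadirashvili–Seregin–Šverák 2009,
  §1: the Liouville conjecture for bounded ancient solutions "is open even in the steady-state
  case").
* `steadyDSolutionLiouvilleProblem_of` — `SubBallisticLiouville` ⇒
  `Literature.Analysis.FluidPDE.SteadyDSolutionLiouvilleProblem`, the tree's registered OPEN
  CONJECTURE (Galdi 2011, §I.2 and Rem. X.9.4; Tsai 2018, Conj. 2.5; Wang 2025, p. 1; Wang–Yang
  2026: "remains open") `[status: open]`.

Proof: a steady classical solution, viewed as the time-independent field `v t := U`, lies in the
crux's eternal class (`isDistributionalNSSolutionOn_of_contDiffOn` gives the weak form against ALL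
tests, the pressure term drops for divergence-free tests, Fubini turns the space–time integral
into the iterated one; the weak gradient is the classical one,
`hasWeakSpatialGradientOn_of_contDiffOn`); boundedness `‖U‖ ≤ K` gives the growth clause with
`h = 0`, `M = 4K²|B₁|`; the crux returns an a.e.-constant slice, continuity makes `U` constant,
and decay at infinity makes the constant `0`.

Consequence for the route: any proof of the crux proves Galdi's Liouville problem and the
bounded-steady Liouville problem; any line for the crux has a stub at least that strong.
-/

noncomputable section

-- `Summit.<Summit>.<Problem>`: single-conjunct summit; duplicate namespace is mandated (CONVENTIONS)
set_option linter.dupNamespace false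

open MeasureTheory TopologicalSpace Set Function Filter Topology Metric
open scoped Laplacian InnerProductSpace RealInnerProductSpace ENNReal NNReal ContDiff
open Literature.Analysis.FluidPDE

namespace Summit.AnomalousDissipation.AnomalousDissipation.Cruxes.SubBallisticLiouville.StrategistR1

open Summit.AnomalousDissipation.AnomalousDissipation.Theses.KolmogorovLiouville
  (SubBallisticLiouville)

/-- **The crux decides the bounded-steady Liouville problem.** If `SubBallisticLiouville` holds,
every bounded `C²/C¹` steady solution of unit-viscosity unforced Navier–Stokes on `ℝ³`
(`IsLerayProfile 1 0 U P`: `−ΔU + (U·∇)U + ∇P = 0`, `div U = 0`) is constant. [folklore] -/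
theorem exists_const_of_isLerayProfile_of_bounded (hC : SubBallisticLiouville)
    {U : EuclideanSpace ℝ (Fin 3) → EuclideanSpace ℝ (Fin 3)} {P : EuclideanSpace ℝ (Fin 3) → ℝ}
    (hprof : IsLerayProfile 1 0 U P) {K : ℝ} (hK : ∀ x, ‖U x‖ ≤ K) :
    ∃ b : EuclideanSpace ℝ (Fin 3), U = fun _ => b := by
  have hU2 : ContDiff ℝ 2 U := hprof.contDiff_velocity
  have hU1 : ContDiff ℝ 1 U := hU2.of_le one_le_two
  have hP1 : ContDiff ℝ 1 P := hprof.contDiff_pressure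
  have hUc : Continuous U := hU2.continuous
  have hK0 : 0 ≤ K := (norm_nonneg _).trans (hK 0)
  have cU : Continuous fun z : ℝ × EuclideanSpace ℝ (Fin 3) => U z.2 := hUc.comp continuous_snd
  have hQ : ((slab (EuclideanSpace ℝ (Fin 3)) univ isOpen_univ :
      Opens (ℝ × EuclideanSpace ℝ (Fin 3))) : Set (ℝ × EuclideanSpace ℝ (Fin 3))) ⊆ univ ×ˢ univ :=
    fun z _ => ⟨mem_univ _, mem_univ _⟩
  -- (1) measurability
  have h1 : AEStronglyMeasurable (uncurry fun _ : ℝ => U)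
      (volume : Measure (ℝ × EuclideanSpace ℝ (Fin 3))) :=
    cU.aestronglyMeasurable
  -- (2) `L^∞_t L²_x` locally
  have h2 : ∀ R : ℝ, 0 < R → ∃ C : ℝ≥0, ∀ᵐ t : ℝ, t ∈ Icc (-R ^ 2) (R ^ 2) →
      ∫⁻ x in ball (0 : EuclideanSpace ℝ (Fin 3)) R, ‖U x‖ₑ ^ 2 ≤ C := by
    intro R _
    have hfin : ENNReal.ofReal K ^ 2 * volume (ball (0 : EuclideanSpace ℝ (Fin 3)) R) ≠ ⊤ :=
      ENNReal.mul_ne_top (ENNReal.pow_ne_top ENNReal.ofReal_ne_top) measure_ball_lt_top.ne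
    refine ⟨(ENNReal.ofReal K ^ 2 * volume (ball (0 : EuclideanSpace ℝ (Fin 3)) R)).toNNReal,
      Eventually.of_forall fun t _ => ?_⟩
    rw [ENNReal.coe_toNNReal hfin]
    calc ∫⁻ x in ball (0 : EuclideanSpace ℝ (Fin 3)) R, ‖U x‖ₑ ^ 2
        ≤ ∫⁻ _ in ball (0 : EuclideanSpace ℝ (Fin 3)) R, ENNReal.ofReal K ^ 2 :=
          setLIntegral_mono measurable_const fun x _ => by
            refine pow_le_pow_left' ?_ 2
            rw [← ofReal_norm]
            exact ENNReal.ofReal_le_ofReal (hK x)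
      _ = ENNReal.ofReal K ^ 2 * volume (ball (0 : EuclideanSpace ℝ (Fin 3)) R) :=
          setLIntegral_const _ _
  -- (3) weakly divergence free slices
  have h3 : ∀ᵐ _t : ℝ, IsWeaklyDivFree U :=
    Eventually.of_forall fun _ => VectorCalculus.IsDivFree.isWeaklyDivFree_holds hprof.divFree hU1
  -- (4) the weak spatial gradient is the classical one, locally square integrable
  have h4 : ∃ G : ℝ → EuclideanSpace ℝ (Fin 3) →
      EuclideanSpace ℝ (Fin 3) →L[ℝ] EuclideanSpace ℝ (Fin 3),
      HasWeakSpatialGradientOn (slab (EuclideanSpace ℝ (Fin 3)) univ isOpen_univ)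
        (fun _ : ℝ => U) G ∧
      ∀ R : ℝ, 0 < R → ∫⁻ z in Icc (-R ^ 2) (R ^ 2) ×ˢ ball (0 : EuclideanSpace ℝ (Fin 3)) R,
        ENNReal.ofReal (frobeniusNormSq (G z.1 z.2)) < ⊤ := by
    refine ⟨fun _ x => fderiv ℝ U x, ?_, ?_⟩
    · have hu1 : ContDiffOn ℝ 1 (uncurry fun _ : ℝ => U) (univ ×ˢ univ) :=
        (hU1.comp contDiff_snd).contDiffOn
      exact hasWeakSpatialGradientOn_of_contDiffOn isOpen_univ hQ hu1
    · intro R _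
      have hc : Continuous fun x : EuclideanSpace ℝ (Fin 3) => frobeniusNormSq (fderiv ℝ U x) :=
        LerayHopfProofs.continuous_frobeniusNormSq.comp (hU1.continuous_fderiv one_ne_zero)
      obtain ⟨Mf, hMf⟩ := (isCompact_closedBall (0 : EuclideanSpace ℝ (Fin 3)) R)
        |>.exists_bound_of_continuousOn hc.continuousOn
      have hle : ∀ z ∈ Icc (-R ^ 2) (R ^ 2) ×ˢ ball (0 : EuclideanSpace ℝ (Fin 3)) R,
          ENNReal.ofReal (frobeniusNormSq (fderiv ℝ U z.2)) ≤ ENNReal.ofReal Mf := by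
        intro z hz
        refine ENNReal.ofReal_le_ofReal ?_
        have := hMf z.2 (ball_subset_closedBall hz.2)
        rwa [Real.norm_of_nonneg (frobeniusNormSq_nonneg _)] at this
      calc ∫⁻ z in Icc (-R ^ 2) (R ^ 2) ×ˢ ball (0 : EuclideanSpace ℝ (Fin 3)) R,
            ENNReal.ofReal (frobeniusNormSq (fderiv ℝ U z.2))
          ≤ ∫⁻ _ in Icc (-R ^ 2) (R ^ 2) ×ˢ ball (0 : EuclideanSpace ℝ (Fin 3)) R,
              ENNReal.ofReal Mf :=
            setLIntegral_mono measurable_const hle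
        _ = ENNReal.ofReal Mf *
              volume (Icc (-R ^ 2) (R ^ 2) ×ˢ ball (0 : EuclideanSpace ℝ (Fin 3)) R) :=
            setLIntegral_const _ _
        _ < ⊤ := ENNReal.mul_lt_top ENNReal.ofReal_lt_top
            ((measure_mono (prod_mono_right ball_subset_closedBall)).trans_lt
              ((isCompact_Icc.prod (isCompact_closedBall _ _)).measure_lt_top))
  -- (5) the pressure-free weak form against divergence-free space–time tests
  have h5 : ∀ ψ : ℝ → EuclideanSpace ℝ (Fin 3) → EuclideanSpace ℝ (Fin 3),
      IsSpaceTimeTestOn (slab (EuclideanSpace ℝ (Fin 3)) univ isOpen_univ) ψ →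
      (∀ t, VectorCalculus.IsDivFree (ψ t)) →
      ∫ t, ∫ x, (⟪U x, timeDeriv ψ t x⟫ + ⟪U x, convect U (ψ t) x⟫ + ⟪U x, Δ (ψ t) x⟫) = 0 := by
    intro ψ hψ hψdiv
    have hu : ContDiffOn ℝ 2 (uncurry fun _ : ℝ => U) (univ ×ˢ univ) :=
      (hU2.comp contDiff_snd).contDiffOn
    have hp : ContDiffOn ℝ 1 (uncurry fun _ : ℝ => P) (univ ×ˢ univ) :=
      (hP1.comp contDiff_snd).contDiffOn
    have hf : ContinuousOn (uncurry fun (_ : ℝ) (_ : EuclideanSpace ℝ (Fin 3)) =>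
        (0 : EuclideanSpace ℝ (Fin 3))) (univ ×ˢ univ) :=
      continuousOn_const
    -- the classical solution is a distributional one (all tests, pressure explicit); the momentum
    -- equation `∂ₜU + (U·∇)U = ΔU − ∇P` is the profile system `IsLerayProfile 1 0` with `∂ₜU = 0`
    obtain ⟨-, -, -, -, hI0⟩ : IsDistributionalNSSolutionOn
        (slab (EuclideanSpace ℝ (Fin 3)) univ isOpen_univ) 1
        (fun (_ : ℝ) (_ : EuclideanSpace ℝ (Fin 3)) => (0 : EuclideanSpace ℝ (Fin 3)))
        (fun _ : ℝ => U) (fun _ : ℝ => P) := by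
      refine isDistributionalNSSolutionOn_of_contDiffOn isOpen_univ hQ hu hp hf (fun t _ x => ?_)
        (fun _ _ => hprof.divFree)
      have h := hprof.profile_eq x
      simp only [one_smul, zero_smul, add_zero] at h
      rw [add_assoc, neg_add_eq_zero] at h
      simp only [timeDeriv_apply, deriv_const, zero_add, one_smul, add_zero]
      rw [h, add_sub_cancel_right]
    have hI := hI0 ψ hψ
    have hdiv0 : ∀ t x, VectorCalculus.divergence (ψ t) x = 0 := fun t x => hψdiv t x
    simp only [hdiv0, mul_zero, add_zero, inner_zero_left, one_mul] at hI
    have hK : IsCompact (tsupport (uncurry ψ)) := hψ.hasCompactSupport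
    have hKQ : tsupport (uncurry ψ) ⊆ ((slab (EuclideanSpace ℝ (Fin 3)) univ isOpen_univ :
        Opens (ℝ × EuclideanSpace ℝ (Fin 3))) : Set (ℝ × EuclideanSpace ℝ (Fin 3))) :=
      hψ.tsupport_subset
    have cT : Continuous fun z : ℝ × EuclideanSpace ℝ (Fin 3) => timeDeriv ψ z.1 z.2 :=
      hψ.continuous_timeDeriv
    have hGc : Continuous fun z : ℝ × EuclideanSpace ℝ (Fin 3) =>
        ⟪U z.2, timeDeriv ψ z.1 z.2⟫ + ⟪U z.2, convect U (ψ z.1) z.2⟫ + ⟪U z.2, Δ (ψ z.1) z.2⟫ :=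
      ((cU.inner cT).add (cU.inner (hψ.continuous_fderiv_slice.clm_apply cU))).add
        (cU.inner hψ.continuous_laplacian_slice)
    have hG0 : ∀ z ∉ tsupport (uncurry ψ),
        ⟪U z.2, timeDeriv ψ z.1 z.2⟫ + ⟪U z.2, convect U (ψ z.1) z.2⟫ + ⟪U z.2, Δ (ψ z.1) z.2⟫
          = 0 := by
      intro z hz
      have e1 : timeDeriv ψ z.1 z.2 = 0 := timeDeriv_eq_zero_off_tsupport hz
      have e2 : fderiv ℝ (ψ z.1) z.2 = 0 :=
        fderiv_of_notMem_tsupport ℝ (notMem_tsupport_slice_of_notMem hz)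
      have e3 : (Δ (ψ z.1)) z.2 = 0 :=
        laplacian_eq_zero_of_notMem_tsupport (notMem_tsupport_slice_of_notMem hz)
      simp only [convect, e1, e2, e3, inner_zero_right, _root_.zero_apply, add_zero]
    rw [setIntegral_eq_integral_integral_of_continuousOn isOpen_univ hK hKQ hQ hGc.continuousOn hG0]
      at hI
    simpa using hI
  -- the growth clause with `h = 0`, `M = 4K²|B₁|`
  have hV : ENNReal.ofReal (volume (ball (0 : EuclideanSpace ℝ (Fin 3)) 1)).toReal =
      volume (ball (0 : EuclideanSpace ℝ (Fin 3)) 1) :=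
    ENNReal.ofReal_toReal measure_ball_lt_top.ne
  have hgrowth : ∀ R : ℝ, 1 ≤ R → ∀ᵐ t : ℝ, t ∈ Icc (-R ^ 2) (R ^ 2) →
      ∫⁻ x in ball (0 : EuclideanSpace ℝ (Fin 3)) R,
          ‖U x - ⨍ y in ball (0 : EuclideanSpace ℝ (Fin 3)) R, U y‖ₑ ^ 2
        ≤ ENNReal.ofReal ((2 * K) ^ 2 * (volume (ball (0 : EuclideanSpace ℝ (Fin 3)) 1)).toReal *
            R ^ (3 + 2 * (0 : ℝ))) := by
    intro R hR
    have hR0 : 0 < R := by linarith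
    refine Eventually.of_forall fun t _ => ?_
    have havg : ‖⨍ y in ball (0 : EuclideanSpace ℝ (Fin 3)) R, U y‖ ≤ K := by
      rw [setAverage_eq, norm_smul, norm_inv, Real.norm_of_nonneg measureReal_nonneg]
      rcases (measureReal_nonneg : 0 ≤ volume.real (ball (0 : EuclideanSpace ℝ (Fin 3)) R)).eq_or_lt
        with h0 | _
      · rw [← h0, inv_zero, zero_mul]
        exact hK0
      · calc (volume.real (ball (0 : EuclideanSpace ℝ (Fin 3)) R))⁻¹ *
              ‖∫ y in ball (0 : EuclideanSpace ℝ (Fin 3)) R, U y‖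
            ≤ (volume.real (ball (0 : EuclideanSpace ℝ (Fin 3)) R))⁻¹ *
                (K * volume.real (ball (0 : EuclideanSpace ℝ (Fin 3)) R)) := by
              gcongr
              exact norm_setIntegral_le_of_norm_le_const measure_ball_lt_top fun x _ => hK x
          _ = K := by field_simp
    have hpt : ∀ x, ‖U x - ⨍ y in ball (0 : EuclideanSpace ℝ (Fin 3)) R, U y‖ₑ ^ 2 ≤
        ENNReal.ofReal ((2 * K) ^ 2) := by
      intro x
      rw [ENNReal.ofReal_pow (by positivity), ← ofReal_norm]
      refine pow_le_pow_left' (ENNReal.ofReal_le_ofReal ?_) 2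
      calc ‖U x - ⨍ y in ball (0 : EuclideanSpace ℝ (Fin 3)) R, U y‖
          ≤ ‖U x‖ + ‖⨍ y in ball (0 : EuclideanSpace ℝ (Fin 3)) R, U y‖ := norm_sub_le _ _
        _ ≤ K + K := add_le_add (hK x) havg
        _ = 2 * K := by ring
    have h3 : R ^ (3 + 2 * (0 : ℝ)) = R ^ (3 : ℕ) := by
      rw [show (3 : ℝ) + 2 * 0 = ((3 : ℕ) : ℝ) by norm_num, Real.rpow_natCast]
    calc ∫⁻ x in ball (0 : EuclideanSpace ℝ (Fin 3)) R,
          ‖U x - ⨍ y in ball (0 : EuclideanSpace ℝ (Fin 3)) R, U y‖ₑ ^ 2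
        ≤ ∫⁻ _ in ball (0 : EuclideanSpace ℝ (Fin 3)) R, ENNReal.ofReal ((2 * K) ^ 2) :=
          setLIntegral_mono measurable_const fun x _ => hpt x
      _ = ENNReal.ofReal ((2 * K) ^ 2) * volume (ball (0 : EuclideanSpace ℝ (Fin 3)) R) :=
          setLIntegral_const _ _
      _ = ENNReal.ofReal ((2 * K) ^ 2) *
            (ENNReal.ofReal (R ^ 3) * volume (ball (0 : EuclideanSpace ℝ (Fin 3)) 1)) := by
          rw [Measure.addHaar_ball_of_pos volume _ hR0, finrank_euclideanSpace_fin]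
      _ = ENNReal.ofReal ((2 * K) ^ 2 * (volume (ball (0 : EuclideanSpace ℝ (Fin 3)) 1)).toReal *
            R ^ (3 + 2 * (0 : ℝ))) := by
          rw [h3, ENNReal.ofReal_mul (by positivity), ENNReal.ofReal_mul (by positivity), hV]
          ring
  -- apply the crux with `h = 0`
  have hC' := hC
  dsimp only [SubBallisticLiouville] at hC'
  have hS := hC' 0 ((2 * K) ^ 2 * (volume (ball (0 : EuclideanSpace ℝ (Fin 3)) 1)).toReal)
    zero_lt_one (fun _ => U) ⟨h1, h2, h3, h4, h5⟩ hgrowth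
  obtain ⟨_, b, hb⟩ := hS.exists
  exact ⟨b, (hUc.ae_eq_iff_eq volume continuous_const).1 hb⟩

/-- **The crux decides Galdi's Liouville problem.** `SubBallisticLiouville` ⇒
`Literature.Analysis.FluidPDE.SteadyDSolutionLiouvilleProblem` (Galdi 2011, §I.2; Tsai 2018,
Conj. 2.5; registered `[status: open]`): a smooth steady solution tending to `0` at infinity is
bounded, hence constant by `exists_const_of_isLerayProfile_of_bounded`, hence `0`. (The finite
Dirichlet integral hypothesis is not even used.) [cite: Galdi2011, §I.2] -/
theorem steadyDSolutionLiouvilleProblem_of (hC : SubBallisticLiouville) :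
    SteadyDSolutionLiouvilleProblem := by
  intro u p hprof _ _ _ hdecay
  have huc : Continuous u := hprof.contDiff_velocity.continuous
  obtain ⟨K, hK⟩ : ∃ K : ℝ, ∀ x, ‖u x‖ ≤ K := by
    have hev : ∀ᶠ x in cocompact (EuclideanSpace ℝ (Fin 3)), dist (u x) 0 < 1 :=
      Metric.tendsto_nhds.1 hdecay 1 one_pos
    obtain ⟨S, hSc, hSsub⟩ := mem_cocompact.1 hev
    obtain ⟨C, hCb⟩ := hSc.exists_bound_of_continuousOn huc.continuousOn
    refine ⟨max C 1, fun x => ?_⟩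
    by_cases hx : x ∈ S
    · exact (hCb x hx).trans (le_max_left _ _)
    · have hx' : dist (u x) 0 < 1 := hSsub hx
      rw [dist_zero_right] at hx'
      exact hx'.le.trans (le_max_right _ _)
  obtain ⟨b, hb⟩ := exists_const_of_isLerayProfile_of_bounded hC hprof hK
  subst hb
  have hb0 : b = 0 := tendsto_const_nhds_iff.1 hdecay
  subst hb0
  rfl

end Summit.AnomalousDissipation.AnomalousDissipation.Cruxes.SubBallisticLiouville.StrategistR1

end
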